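import Summits.QuantumFields.BalabanUV.Beta.EriceRemainderEnclosureHistoryAutonomyComparisonAgeCompositionStaticEndEnteringAbs
import Summits.QuantumFields.BalabanUV.Beta.EriceRemainderEnclosureHistoryAutonomyComparisonAgeCompositionThreeAgesEntering

/-!
# EriceRemainderEnclosureHistoryAutonomyComparisonAgeCompositionThreeAgesAbs — (E87n) route (N), first order: (E86h)'s flow END and three-age sockets with the per-pair
# entering-lag family in the forms (S-h♭) OR (S-h°) — (S-h°) ((E87k)∕(E87l)): ABSOLUTE young lower masses, lag-wise `max` of the KEY bound against the top
# truncation surplus's minorant `1 − x̃_{k₃}` (at the pin `m+2` or at the lag's own pin), the CHAIN-FREE bound `1 − x̃_{k₃} − x̃_{k₂}`, and `0`; no growth factor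

Cell `pub-balaban`, β-function sub-cell, BINDER row D4 «RemainderConst leaves for Bałaban's split» (`HOME/BINDER-OWNERS.md`; owner lineage `b2b-balaban-beta-an4`;
this file by co-owner #2 lineage `b2b-balaban-beta-d4-p2`, generation 78), β-FLOW TEAM duty (1), FREEZE (0) honoured (def-free; imports (E87l), (E86h);
uses (E87l) `nonneg_and_drop_ratio_all_ages_entering_abs`, (E86h) `flow_M1_top_of_crit`, (E86a) `sum_range_of_le` ∕ `aggregate_eq_zero_of_horizon`, (E80d)
`aggregate_eq_sum`, (E83b) `flow_onelag_structure` ∕ `flow_sigma_mem`, (E81d) `flow_cum_dom_of_rowmass`, (E82c) `kernel_zero` BY NAME; (E86h) §1∕§2∕§4 copied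
with ONE hypothesis re-cut; nothing else restated).

HONEST FRAMING (page 1, verbatim and binding).  *"Discharging BetaPertH makes Bałaban's UV stability UNCONDITIONAL — a real constructive-QFT result; it is
NOT the continuum limit and NOT the Clay problem."*  THIS FILE DISCHARGES NOTHING OF THE KIND.  Elementary real analysis about ABSTRACT functionals on a box
]0,γ]^ℕ with displayed floors, profiles and signs, and the FIRST-ORDER renewal objects of route (N) built from them — hypotheses of a census, not facts; the
form, signs, ages and moments of Bałaban's (1.22) limit functional are NOT PRINTED ([I] p. 298; GAPS G-t4-U2-1∕-2) and NOT asserted.  Row D4 class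
UNCHANGED (critical-path width 0; instance 0∕1; D4 DISCHARGE NO DATE).  HONEST DEPENDENCY: continuum YM on T⁴ ⇐ BetaPertH ∧ nine spine estimates (0/9
proved); BetaPertH ⇐ (D1) ∧ (D4) ∧ CAP+tail; G-an2-4 gates asym, D1 and NE2/3/4.

THE POINT (census sense (α); route (N); README `HOME/b2b-balaban-beta-d4-p2/g78/e87/README.md` §2–§3).  (E87h)'s (S-h♯) bounds every young drop through
the KEY ratio; its damping-free form needs a majorant of `ρ_{k₂}`, and the flow majorant `ρUp` of (E87i) exceeds `1` where two comparably long old ages are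
both loaded (generation-78 adversarial census) — the young lower mass is clipped to `0` there.  (S-h°) adds the chain-free branch `t ≥ v − Ry v ≥
1 − x̃_{k₃} − x̃_{k₂}`, positive exactly there.  §0 **`nonneg_of_static_families_entering_abs`**: the END of (E87l) in abstract letters ((E86g)'s wrapper).  §1 **`flow_nonneg_of_static_families_entering_abs_horizon`**: (E86h) §1 on §0 with the displayed letters
`Tτ i m p'`, `TA i j m p` (their `K`-range sums re-summed on the horizon inside).  §2 **`flow_nonneg_three_ages_abs_horizon`**: THE THREE-AGE SOCKET v2° —
`hpair23` := (S-a)_{k₃} ∨ (S-h♭)_{(k₂,k₃)} ∨ **(S-h°)_{(k₂,k₃)}**: `KL k₃ (m+1)(k₃−1)·Σ_{l<k₂} [m+2+k₃+l ≤ j]·KL k₂ (m+1+k₃) l ≤ θ_{k₃}(m;1)·Σ_{l'<k₃} KL k₃ m l'·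
TA k₂ j m (m+1+l') + (1−θ_{k₃}(m;1))·KL k₃ m 0·TA k₂ j m (m+1)` with `TA k₂ j m p = Σ_{l<k₂} [p+1+l ≤ j]·KL k₂ p l·Tτ k₂ m (p+1+l)` and `Tτ k₂ m p' =
max((1−ρ_{k₂}(p'))(1 − Σ_l KA (k₂+1) (m+2) l), (1−ρ_{k₂}(p'))(1 − Σ_l KA (k₂+1) p' l), 1 − Σ_l KA (k₂+1) p' l − Σ_l KL k₂ p' l, 0)` (`KA (k₂+1) = KL k₃`).
Census g78 (`shcomb.py`, bench, pins `≤ 2`, `k₃ ≤ 32`): (S-h°) log-ratio `−0.63 … −1.07` ((S-h♯): `−0.60 … −0.86`); damping-free `−0.60∕−0.45∕−0.34` ((S-h♯)'s: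
`−0.53∕−0.39∕−0.29`).  §3 **`flow_nonneg_three_ages_abs_static`**: SOCKET v3° (second members (S-d), (S-e″), (S-h°), (S-f)).  NOT CLAIMED: any family along
flows; four or more loaded ages; anything nonlinear; anything printed — NOT B12 Thm 2, NOT BetaPertH.

WHAT IS PROVED ([folklore]; 0 `def`, 0 sorry).  §0 **`nonneg_of_static_families_entering_abs`**; §1 **`flow_nonneg_of_static_families_entering_abs_horizon`**;
§2 **`flow_nonneg_three_ages_abs_horizon`**; §3 **`flow_nonneg_three_ages_abs_static`**.
-/
noncomputable section
open Finset

namespace Summit.QuantumFields.BalabanUV.Beta.EriceRemainderEnclosureHistoryAutonomyComparisonAgeCompositionThreeAgesAbs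

open Literature.MathematicalPhysics.QuantumFieldTheory.Balaban1983to89
open Literature.MathematicalPhysics.QuantumFieldTheory.Balaban1983to89.T4BetaStationary
open Literature.MathematicalPhysics.QuantumFieldTheory.Balaban1983to89.T4BetaFlowWellPosed
open Summit.QuantumFields.BalabanUV.Beta.EriceRemainderEnclosureHistoryAutonomyOrder (strictAnti_of_memFlow)
open Summit.QuantumFields.BalabanUV.Beta.EriceRemainderEnclosureHistoryAutonomyComparisonAgeCompositionIdentification
open Summit.QuantumFields.BalabanUV.Beta.EriceRemainderEnclosureHistoryAutonomyComparisonAgeCompositionChainWiringAtPin (age_chain_closes)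
open Summit.QuantumFields.BalabanUV.Beta.EriceRemainderEnclosureHistoryAutonomyComparisonAgeCompositionCriteriaFlow (flow_shift_domination flow_cum_dom_of_rowmass)
open Summit.QuantumFields.BalabanUV.Beta.EriceRemainderEnclosureHistoryAutonomyComparisonAgeCompositionStaticEndFlow (flow_lag_zero_mass_lt_one)
open Summit.QuantumFields.BalabanUV.Beta.EriceRemainderEnclosureHistoryAutonomyComparisonAgeCompositionStaticEndOldestFlow (silent_tail_sums)
open Summit.QuantumFields.BalabanUV.Beta.EriceRemainderEnclosureHistoryAutonomyComparisonAgeCompositionYoungestTailSumWiring (kernel_zero)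
open Summit.QuantumFields.BalabanUV.Beta.EriceRemainderEnclosureHistoryAutonomyComparisonAgeCompositionEnteringLagFlow
  (flow_onelag_structure flow_sigma_mem flow_onelag_decay flow_trunc_key)
open Summit.QuantumFields.BalabanUV.Beta.EriceRemainderEnclosureHistoryAutonomyComparisonAgeCompositionEnteringLag (mono2_top_of_onelag)
open Summit.QuantumFields.BalabanUV.Beta.EriceRemainderEnclosureHistoryAutonomyComparisonAgeComposition (sol_unique)
open Summit.QuantumFields.BalabanUV.Beta.EriceRemainderEnclosureHistoryAutonomyComparisonAgeCompositionChainWiring (aggregate_eq_sum)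
open Summit.QuantumFields.BalabanUV.Beta.EriceRemainderEnclosureHistoryAutonomyComparisonAgeCompositionStaticEnd (truncation_admissible)
open Summit.QuantumFields.BalabanUV.Beta.EriceRemainderEnclosureHistoryAutonomyComparisonAgeCompositionDecayHorizon (sum_range_of_le aggregate_eq_zero_of_horizon)
open Summit.QuantumFields.BalabanUV.Beta.EriceRemainderEnclosureHistoryAutonomyComparisonAgeCompositionStaticEndEnteringAbs (nonneg_and_drop_ratio_all_ages_entering_abs)
open Summit.QuantumFields.BalabanUV.Beta.EriceRemainderEnclosureHistoryAutonomyComparisonAgeCompositionThreeAgesEntering (flow_M1_top_of_crit)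

/-! ## §0 (E87l)'s END (abstract letters) -/

section AbstractEnd
open Summit.QuantumFields.BalabanUV.Beta.EriceRemainderEnclosureHistoryAutonomyComparisonAgeComposition (sol_unique)
variable {N n : ℕ} {KL KA : ℕ → ℕ → ℕ → ℝ} {RL RA SL SA : ℕ → (ℕ → ℝ) → ℕ → ℝ} {y : ℕ → ℕ} {θ : ℕ → ℕ → ℕ → ℝ}

/-- **ROUTE (N), FIRST ORDER, END — ENTERING-LAG OPTIONS WITH (S-h♭) OR (S-h°) (abstract letters).**  As (E86g) `nonneg_of_static_families_entering_free`
on (E87l) `nonneg_and_drop_ratio_all_ages_entering_abs`: `ε ≥ 0` for every admissible excess. [folklore] -/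
theorem nonneg_of_static_families_entering_abs
    (hKL : ∀ i m l, 0 ≤ KL i m l) (hKLN : ∀ i m l, N ≤ l → KL i m l = 0) (hKLy : ∀ i m l, y i ≤ l → KL i m l = 0)
    (hRL : ∀ i v m, RL i v m = ∑ l ∈ range N, KL i m l * v (m + 1 + l))
    (hRA : ∀ i v m, RA i v m = ∑ l ∈ range N, KA i m l * v (m + 1 + l))
    (hKA : ∀ i m l, KA i m l = KL i m l + KA (i + 1) m l) (hKAtop : ∀ m l, KA (n + 1) m l = 0)
    (hSL : ∀ i (w : ℕ → ℝ), (∀ m, N < m → w m = 0) → (∀ m, N < m → SL i w m = 0) ∧ ∀ m, SL i w m = w m - RL i (SL i w) m)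
    (hSA : ∀ i (w : ℕ → ℝ), (∀ m, N < m → w m = 0) → (∀ m, N < m → SA i w m = 0) ∧ ∀ m, SA i w m = w m - RA i (SA i w) m)
    (hy : ∀ i, 1 ≤ i → i ≤ n → 1 ≤ y i ∧ y i ≤ N)
    (hθ0 : ∀ k m l, 0 ≤ θ k m l) (hpers : ∀ k m l i', (1 - θ k m l) * KL k m (i' + l) ≤ KL k (m + l) i')
    (hθmono : ∀ k m l l', l ≤ l' → θ k m l ≤ θ k m l')
    {ρ : ℕ → ℕ → ℝ} {β : ℕ → ℕ → ℕ → ℝ}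
    (hρ : ∀ i m, 1 ≤ i → i ≤ n → ρ i m = (∑ l ∈ range N, KL i m l) * (1 + ∑ k ∈ Ioc i n, θ k m (y i) * β (i + 1) m k) /
      (1 - ∑ k ∈ Ioc i n, ∑ l ∈ range (y i), KL k m l))
    (hβnew : ∀ i m, 1 ≤ i → i ≤ n → β i m i = ρ i m / (1 - ρ i m))
    (hβold : ∀ i m k, 1 ≤ i → i < k → k ≤ n → β i m k = β (i + 1) m k / (1 - ρ i m))
    (hΩ1 : ∀ i m, 1 ≤ i → i ≤ n → ∑ k ∈ Ioc i n, ∑ l ∈ range (y i), KL k m l < 1)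
    (hclose : ∀ i m, 1 ≤ i → i ≤ n → ρ i m < 1)
    (hshift : ∀ k m l, l + 1 < y k → KL k (m + 1) l ≤ KL k m (l + 1))
    (hΩ0 : ∀ i m, i ≤ n → ∑ k ∈ Ioc i n, KL k m 0 < 1)
    {Hg : ℕ → ℕ → ℝ} (hH : ∀ i m, Hg i m = (1 + ∑ k ∈ Ioc i n, θ k m 1 * β (i + 1) m k) / (1 - ∑ k ∈ Ioc i n, KL k m 0))
    {σ : ℕ → ℕ → ℝ} (hσ1 : ∀ k m l, l + 1 < y k → KL k (m + 1) l = σ k m * KL k m (l + 1)) (hσ01 : ∀ k m, 0 ≤ σ k m ∧ σ k m ≤ 1)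
    {AL : ℕ → ℕ → ℕ → ℝ} (hAL : ∀ i j p, AL i j p = ∑ l ∈ range (y i), if p + 1 + l ≤ j then KL i p l * (1 - ρ i (p + 1 + l)) else 0)
    {Tτ : ℕ → ℕ → ℕ → ℝ} (hTτ : ∀ i m p', Tτ i m p' = max (max (max ((1 - ρ i p') * (1 - ∑ l ∈ range N, KA (i + 1) (m + 2) l))
      ((1 - ρ i p') * (1 - ∑ l ∈ range N, KA (i + 1) p' l))) ((1 - ∑ l ∈ range N, KA (i + 1) p' l) - ∑ l ∈ range N, KL i p' l)) 0)
    {TA : ℕ → ℕ → ℕ → ℕ → ℝ} (hTA : ∀ i j m p, TA i j m p = ∑ l ∈ range (y i), if p + 1 + l ≤ j then KL i p l * Tτ i m (p + 1 + l) else 0)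
    {P : ℕ → Prop}
    (hMONOopt : ∀ i k, 1 ≤ i → i < k → k ≤ n →
      (∀ m L, ∑ l ∈ range (L + 1), KL k (m + 1) l ≤ ∑ l ∈ range (L + 2), KL k m l) ∨ (∀ m l, KL i m l = 0) ∨
      (y i = 1 ∧ ∀ m, KL k (m + 1) (y k - 1) * KL i (m + 1 + y k) 0 * ∏ p ∈ Ico (m + 2) (m + 2 + y k), Hg i p ≤
        KL k m 0 * KL i (m + 1) 0 * (1 - KL i (m + 2) 0 * Hg i (m + 2))) ∨
      (P (i + 1) ∧ ((∀ j m, m + 1 + y k ≤ j →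
        KL k (m + 1) (y k - 1) * ∑ l ∈ range (y i), (if m + 2 + y k + l ≤ j then KL i (m + 1 + y k) l * ∏ s ∈ Ico (m + 2) (m + 2 + y k + l), Hg i s else 0) ≤
          (1 - σ k m) * ∑ l' ∈ range (y k), KL k m l' * AL i j (m + 1 + l') + σ k m * (KL k m 0 * AL i j (m + 1))) ∨
        (∀ j m, m + 1 + y k ≤ j →
        KL k (m + 1) (y k - 1) * ∑ l ∈ range (y i), (if m + 2 + y k + l ≤ j then KL i (m + 1 + y k) l else 0) ≤
          (1 - σ k m) * ∑ l' ∈ range (y k), KL k m l' * TA i j m (m + 1 + l') + σ k m * (KL k m 0 * TA i j m (m + 1))))))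
    {M : ℕ → ℕ → ℝ} (hM : ∀ i m, M i m = KL i m 0 + ∑ l ∈ range (N - 1), max (KL i m (l + 1) - KL i (m + 1) l) 0)
    {HgS : ℕ → ℕ → ℕ → ℝ} (hHS : ∀ i j m, HgS i j m = (1 + ∑ k ∈ Ioc i n, θ k m 1 * β (i + 1) m k) /
      (1 - ∑ k ∈ Ioc i n, (KL k m 0 - if m + 1 + y k ≤ j then KL k (m + 1) (y k - 1) else 0)))
    (hlev : ∀ i, 1 ≤ i → i < n →
      (y i = 1 ∧ ∀ m, (1 + M i m) * (Hg i (m + 1) * KL i (m + 1) 0) ≤ KL i m 0) ∨ (∀ m l, KL i m l = 0) ∨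
      (P (i + 1) ∧ (∀ m L', L' < y i → (1 + M i m) * ∑ l ∈ Ico L' (y i), Hg i (m + 1 + l) * KL i (m + 1) l ≤ ∑ l ∈ Ico L' (y i), KL i m l) ∧
        (∀ m L, L < y i → ∀ L', L' ≤ L → (1 + M i m) * ∑ l ∈ Ico L' L, Hg i (m + 1 + l) * KL i (m + 1) l ≤ ∑ l ∈ Ico L' (L + 1), KL i m l)) ∨
      (∀ m, KL i (m + 1) (y i - 1) ≤ (1 - σ i m) * ∑ l ∈ range (y i), KL i m l * (1 - ρ i (m + 1 + l)) / ∏ p ∈ Ico (m + 1 + l) (m + 1 + y i), Hg i p +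
        σ i m * (KL i m 0 * (1 - ρ i (m + 1)) / ∏ p ∈ Ico (m + 1) (m + 1 + y i), Hg i p)))
    (hM1opt : ∀ i, 1 ≤ i → i ≤ n → P i →
      ((∀ m j, m + 1 + N ≤ j → ∀ L', L' < N → ∑ l ∈ Ico L' N, HgS (i - 1) j (m + 1 + l) * KA i (m + 1) l ≤ ∑ l ∈ Ico L' N, KA i m l) ∧
       (∀ m L, L < N → ∀ L', L' ≤ L → ∑ l ∈ Ico L' L, HgS (i - 1) (m + 1 + L) (m + 1 + l) * KA i (m + 1) l ≤ ∑ l ∈ Ico L' (L + 1), KA i m l)) ∨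
      (∀ j, j ≤ N → ∀ m, m < j → SA i (fun m => if m ≤ j then (1:ℝ) else 0) m ≤ SA i (fun m => if m ≤ j then (1:ℝ) else 0) (m + 1)))
    {e ε : ℕ → ℝ} (he0 : ∀ m, 0 ≤ e m) (hea : ∀ m, e (m + 1) ≤ e m) (het : ∀ m, N < m → e m = 0)
    (hεt : ∀ m, N < m → ε m = 0) (hεrec : ∀ m, ε m = e m - RA 1 ε m) : ∀ m, 0 ≤ ε m := by
  rcases Nat.eq_zero_or_pos n with hn0 | hn0
  · subst hn0; intro m; rw [hεrec m, hRA, sum_eq_zero fun l _ => by rw [hKAtop, zero_mul]]; linarith [he0 m]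
  have h := (nonneg_and_drop_ratio_all_ages_entering_abs hKL hKLN hKLy hRL hRA hKA hKAtop hSL hSA hy hθ0 hpers hθmono hρ hβnew hβold hΩ1 hclose
    hshift hΩ0 hH hσ1 hσ01 hAL hTτ hTA hMONOopt hM hHS hlev hM1opt 1 le_rfl (by omega)).2.1 e he0 hea het
  have heq : ∀ m, ε m = SA 1 e m := sol_unique (hRA 1) hεt hεrec (hSA 1 e het).1 (hSA 1 e het).2
  exact fun m => (heq m).symm ▸ h.1 m

end AbstractEnd

variable {B : (ℕ → ℝ) → ℝ} {γ b gIR : ℝ} {L : ℕ → ℝ} {K : ℕ} {h g : ℕ → ℝ} {KL : ℕ → ℕ → ℕ → ℝ}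

/-! ## §1 (E87m)'s END for the flow, general horizon -/

/-- **ROUTE (N), FIRST ORDER, END FOR THE FLOW — ENTERING-LAG OPTIONS WITH (S-h♭) OR (S-h°), GENERAL HORIZON.**  As (E86h)
`flow_nonneg_of_static_families_entering_horizon` on (E87m) `nonneg_of_static_families_entering_abs`: the fourth per-pair option is `P(i+1)` ∧ ((S-h♭) ∨
(S-h°)) with the displayed letters `Tτ`, `TA` (their sums on `range K`, re-summed on the horizon inside). [folklore] -/
theorem flow_nonneg_of_static_families_entering_abs_horizon (hmono : ∀ u v : ℕ → ℝ, SeqBox γ u → SeqBox γ v → (∀ j, u j ≤ v j) → B u ≤ B v)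
    (hL : ∀ k, 0 ≤ L k) (hb : 0 < b) (hlo : ∀ u, SeqBox γ u → b ≤ B u) (hdom : ∀ u, SeqBox γ u → ∑ k ∈ range K, L k * u k ≤ B u)
    (hh : SeqBox γ h) (hf : MemFlow B gIR h)
    (hg : ∀ t, 0 < g t ∧ g t ≤ 1) (hgF : ∀ t, 1 / (1 + ∑ k ∈ range K, L k * h (t + k) ^ 3 / 2) ≤ g t) (hK : 2 ≤ K) {N : ℕ} (hKN : K ≤ N)
    (hKL : ∀ k n l, KL k n l = if 0 < k ∧ k < K ∧ l < k then L k * h (n + k) ^ 3 / 2 * ∏ t ∈ Ico (n + 1 + l) (n + k + 1), g t else 0)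
    {θ : ℕ → ℕ → ℕ → ℝ} (hθ : ∀ k n l, θ k n l = 1 - (h (n + k + l) / h (n + k)) ^ 3 * ∏ t ∈ Ico (n + k + 1) (n + k + l + 1), g t)
    {KA : ℕ → ℕ → ℕ → ℝ} {RL RA SL SA : ℕ → (ℕ → ℝ) → ℕ → ℝ}
    (hRL : ∀ i v m, RL i v m = ∑ l ∈ range K, KL i m l * v (m + 1 + l))
    (hRA : ∀ i v m, RA i v m = ∑ l ∈ range K, KA i m l * v (m + 1 + l))
    (hKA : ∀ i m l, KA i m l = KL i m l + KA (i + 1) m l) (hKAtop : ∀ m l, KA K m l = 0)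
    (hSL : ∀ i (w : ℕ → ℝ), (∀ m, N < m → w m = 0) → (∀ m, N < m → SL i w m = 0) ∧ ∀ m, SL i w m = w m - RL i (SL i w) m)
    (hSA : ∀ i (w : ℕ → ℝ), (∀ m, N < m → w m = 0) → (∀ m, N < m → SA i w m = 0) ∧ ∀ m, SA i w m = w m - RA i (SA i w) m)
    {ρ : ℕ → ℕ → ℝ} {β : ℕ → ℕ → ℕ → ℝ}
    (hρ : ∀ i n, 1 ≤ i → i ≤ K - 1 → ρ i n = (∑ l ∈ range K, KL i n l) * (1 + ∑ k ∈ Ioc i (K - 1), θ k n i * β (i + 1) n k) /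
      (1 - ∑ k ∈ Ioc i (K - 1), ∑ l ∈ range i, KL k n l))
    (hβnew : ∀ i n, 1 ≤ i → i ≤ K - 1 → β i n i = ρ i n / (1 - ρ i n))
    (hβold : ∀ i n k, 1 ≤ i → i < k → k ≤ K - 1 → β i n k = β (i + 1) n k / (1 - ρ i n))
    {Hg : ℕ → ℕ → ℝ} (hH : ∀ i m, Hg i m = (1 + ∑ k ∈ Ioc i (K - 1), θ k m 1 * β (i + 1) m k) / (1 - ∑ k ∈ Ioc i (K - 1), KL k m 0))
    {AL : ℕ → ℕ → ℕ → ℝ} (hAL : ∀ i j p, AL i j p = ∑ l ∈ range i, if p + 1 + l ≤ j then KL i p l * (1 - ρ i (p + 1 + l)) else 0)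
    {Tτ : ℕ → ℕ → ℕ → ℝ} (hTτ : ∀ i m p', Tτ i m p' = max (max (max ((1 - ρ i p') * (1 - ∑ l ∈ range K, KA (i + 1) (m + 2) l))
      ((1 - ρ i p') * (1 - ∑ l ∈ range K, KA (i + 1) p' l))) ((1 - ∑ l ∈ range K, KA (i + 1) p' l) - ∑ l ∈ range K, KL i p' l)) 0)
    {TA : ℕ → ℕ → ℕ → ℕ → ℝ} (hTA : ∀ i j m p, TA i j m p = ∑ l ∈ range i, if p + 1 + l ≤ j then KL i p l * Tτ i m (p + 1 + l) else 0)
    {P : ℕ → Prop}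
    (hMONOopt : ∀ i k, 1 ≤ i → i < k → k ≤ K - 1 →
      (∀ m M', ∑ l ∈ range (M' + 1), KL k (m + 1) l ≤ ∑ l ∈ range (M' + 2), KL k m l) ∨ (∀ m l, KL i m l = 0) ∨
      (i = 1 ∧ ∀ m, KL k (m + 1) (k - 1) * KL i (m + 1 + k) 0 * ∏ p ∈ Ico (m + 2) (m + 2 + k), Hg i p ≤
        KL k m 0 * KL i (m + 1) 0 * (1 - KL i (m + 2) 0 * Hg i (m + 2))) ∨
      (P (i + 1) ∧ ((∀ j m, m + 1 + k ≤ j →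
        KL k (m + 1) (k - 1) * ∑ l ∈ range i, (if m + 2 + k + l ≤ j then KL i (m + 1 + k) l * ∏ s ∈ Ico (m + 2) (m + 2 + k + l), Hg i s else 0) ≤
          (1 - (1 - θ k m 1)) * ∑ l' ∈ range k, KL k m l' * AL i j (m + 1 + l') + (1 - θ k m 1) * (KL k m 0 * AL i j (m + 1))) ∨
        (∀ j m, m + 1 + k ≤ j →
        KL k (m + 1) (k - 1) * ∑ l ∈ range i, (if m + 2 + k + l ≤ j then KL i (m + 1 + k) l else 0) ≤
          (1 - (1 - θ k m 1)) * ∑ l' ∈ range k, KL k m l' * TA i j m (m + 1 + l') + (1 - θ k m 1) * (KL k m 0 * TA i j m (m + 1))))))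
    {M : ℕ → ℕ → ℝ} (hM : ∀ i m, M i m = KL i m 0 + ∑ l ∈ range (K - 1), max (KL i m (l + 1) - KL i (m + 1) l) 0)
    {HgS : ℕ → ℕ → ℕ → ℝ} (hHS : ∀ i j m, HgS i j m = (1 + ∑ k ∈ Ioc i (K - 1), θ k m 1 * β (i + 1) m k) /
      (1 - ∑ k ∈ Ioc i (K - 1), (KL k m 0 - if m + 1 + k ≤ j then KL k (m + 1) (k - 1) else 0)))
    (hlev : ∀ i, 1 ≤ i → i < K - 1 →
      (i = 1 ∧ ∀ m, (1 + M i m) * (Hg i (m + 1) * KL i (m + 1) 0) ≤ KL i m 0) ∨ (∀ m l, KL i m l = 0) ∨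
      (P (i + 1) ∧ (∀ m L', L' < i → (1 + M i m) * ∑ l ∈ Ico L' i, Hg i (m + 1 + l) * KL i (m + 1) l ≤ ∑ l ∈ Ico L' i, KL i m l) ∧
        (∀ m L₀, L₀ < i → ∀ L', L' ≤ L₀ → (1 + M i m) * ∑ l ∈ Ico L' L₀, Hg i (m + 1 + l) * KL i (m + 1) l ≤ ∑ l ∈ Ico L' (L₀ + 1), KL i m l)) ∨
      (∀ m, KL i (m + 1) (i - 1) ≤ (1 - (1 - θ i m 1)) * ∑ l ∈ range i, KL i m l * (1 - ρ i (m + 1 + l)) / ∏ p ∈ Ico (m + 1 + l) (m + 1 + i), Hg i p +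
        (1 - θ i m 1) * (KL i m 0 * (1 - ρ i (m + 1)) / ∏ p ∈ Ico (m + 1) (m + 1 + i), Hg i p)))
    (hM1opt : ∀ i, 1 ≤ i → i ≤ K - 1 → P i →
      ((∀ m j, m + 1 + N ≤ j → ∀ L', L' < N → ∑ l ∈ Ico L' N, HgS (i - 1) j (m + 1 + l) * KA i (m + 1) l ≤ ∑ l ∈ Ico L' N, KA i m l) ∧
       (∀ m L₀, L₀ < N → ∀ L', L' ≤ L₀ → ∑ l ∈ Ico L' L₀, HgS (i - 1) (m + 1 + L₀) (m + 1 + l) * KA i (m + 1) l ≤ ∑ l ∈ Ico L' (L₀ + 1), KA i m l)) ∨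
      (∀ j, j ≤ N → ∀ m, m < j → SA i (fun m => if m ≤ j then (1:ℝ) else 0) m ≤ SA i (fun m => if m ≤ j then (1:ℝ) else 0) (m + 1)))
    {e ε : ℕ → ℝ} (he0 : ∀ m, 0 ≤ e m) (hea : ∀ m, e (m + 1) ≤ e m) (het : ∀ m, N < m → e m = 0)
    (hεt : ∀ m, N < m → ε m = 0) (hεrec : ∀ m, ε m = e m - RA 1 ε m) : ∀ m, 0 ≤ ε m := by
  have hh0 : ∀ n, 0 < h n := fun n => (hh n).1
  have hanti := (strictAnti_of_memFlow hb hlo hh hf).antitone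
  have hac := fun n i (hi1 : 1 ≤ i) (hiK : i ≤ K - 1) =>
    age_chain_closes hmono hL hb hlo hdom hh hf hg hgF hKL hθ hρ hβnew hβold n hi1 hiK
  have hKLK : ∀ i m l, K ≤ l + 1 → KL i m l = 0 := fun i m l hl => by rw [hKL, if_neg (by omega)]
  have hKLtop : ∀ i m l, K ≤ i → KL i m l = 0 := fun i m l hi => by rw [hKL, if_neg (by omega)]
  have hKA0 : ∀ i m l, K ≤ l → KA i m l = 0 :=
    aggregate_eq_zero_of_horizon hKA hKAtop (fun i m l hl => hKLK i m l (by omega)) hKLtop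
  have hRL' : ∀ i v m, RL i v m = ∑ l ∈ range N, KL i m l * v (m + 1 + l) := fun i v m => by
    rw [hRL]; exact sum_range_of_le hKN fun l hl => by rw [hKLK i m l (by omega), zero_mul]
  have hRA' : ∀ i v m, RA i v m = ∑ l ∈ range N, KA i m l * v (m + 1 + l) := fun i v m => by
    rw [hRA]; exact sum_range_of_le hKN fun l hl => by rw [hKA0 i m l hl, zero_mul]
  have hρ' : ∀ i n, 1 ≤ i → i ≤ K - 1 → ρ i n = (∑ l ∈ range N, KL i n l) * (1 + ∑ k ∈ Ioc i (K - 1), θ k n i * β (i + 1) n k) /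
      (1 - ∑ k ∈ Ioc i (K - 1), ∑ l ∈ range i, KL k n l) := fun i n hi1 hiK => by
    rw [hρ i n hi1 hiK, sum_range_of_le hKN fun l hl => hKLK i n l (by omega)]
  have hM' : ∀ i m, M i m = KL i m 0 + ∑ l ∈ range (N - 1), max (KL i m (l + 1) - KL i (m + 1) l) 0 := fun i m => by
    rw [hM, sum_range_of_le (show K - 1 ≤ N - 1 by omega) fun l hl => by
      rw [hKLK i m (l + 1) (by omega), hKLK i (m + 1) l (by omega), sub_zero, max_self]]
  refine nonneg_of_static_families_entering_abs (N := N) (n := K - 1) (y := fun i => i) (KL := KL) (θ := θ) (σ := fun k m => 1 - θ k m 1)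
    (weight_nonneg hL hh0 hg hKL) (fun i m l hl => hKLK i m l (by omega))
    (fun i m l hl => by rw [hKL, if_neg (fun h3 => by omega)])
    hRL' hRA' hKA (fun m l => by rw [Nat.sub_add_cancel (by omega : 1 ≤ K)]; exact hKAtop m l) hSL hSA
    (fun i hi1 hiK => ⟨hi1, by omega⟩)
    (defect_nonneg hh0 hanti hg hθ) (persistence hL hh0 hg hKL hθ) (fun k m l l' hll' => defect_mono hh0 hanti hg hθ k m hll')
    hρ' hβnew hβold (fun i m hi1 hiK => (hac m i hi1 hiK).2) (fun i m hi1 hiK => (hac m i hi1 hiK).1)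
    (fun k m l hl => flow_shift_domination hL hh0 hanti hg hKL k m l hl)
    (fun i m _ => flow_lag_zero_mass_lt_one hmono hL hb hlo hdom hh hf hg hKL i m) hH
    (fun k m l hl => flow_onelag_structure hh hKL hθ k m l hl) (fun k m => ⟨(flow_sigma_mem hh hanti hg hθ k m).1.le, (flow_sigma_mem hh hanti hg hθ k m).2⟩)
    hAL (fun i m p' => ?_) hTA hMONOopt hM' hHS hlev hM1opt he0 hea het hεt hεrec
  -- the displayed letter `Tτ`: its `K`-range sums re-summed on `range N`
  rw [hTτ, sum_range_of_le hKN fun l hl => hKA0 (i + 1) (m + 2) l hl, sum_range_of_le hKN fun l hl => hKA0 (i + 1) p' l hl,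
    sum_range_of_le hKN fun l hl => hKLK i p' l (by omega)]

/-! ## §2 The three-age socket on the entering-lag families, (S-h♭) or (S-h°) -/

/-- **ROUTE (N), FIRST ORDER — THE THREE-AGE SOCKET v2°: THE DAMPED END FOR `{1, k₂, k₃}` ON THE ENTERING-LAG FAMILIES, EVERY HORIZON, EVERY
DAMPING OF THE RELAXED CLASS.**  As (E86h) `flow_nonneg_three_ages_entering_horizon` with `hpair23` := (S-a)_{k₃} ∨ (S-h♭)_{(k₂,k₃)} ∨ (S-h°)_{(k₂,k₃)}, the last
being `KL k₃ (m+1)(k₃−1)·Σ_{l<k₂} [m+2+k₃+l ≤ j]·KL k₂ (m+1+k₃) l ≤ θ_{k₃}(m;1)·Σ_{l'<k₃} KL k₃ m l'·TA k₂ j m (m+1+l') + (1−θ_{k₃}(m;1))·KL k₃ m 0·TA k₂ j m (m+1)`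
for every `j ≥ m+1+k₃`, with the ABSOLUTE young lower masses `TA` displayed (`Tτ`'s three branches; `KA (k₂+1) = KL k₃`).  Census g78: (S-h°) log-ratio
`−0.63 … −1.07` on the benchmark three-age flows (`k₃ ≤ 32`, four classes, pins `≤ 2`). [folklore] -/
theorem flow_nonneg_three_ages_abs_horizon (hmono : ∀ u v : ℕ → ℝ, SeqBox γ u → SeqBox γ v → (∀ j, u j ≤ v j) → B u ≤ B v)
    (hL : ∀ k, 0 ≤ L k) (hb : 0 < b) (hlo : ∀ u, SeqBox γ u → b ≤ B u) (hdom : ∀ u, SeqBox γ u → ∑ k ∈ range K, L k * u k ≤ B u)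
    (hh : SeqBox γ h) (hf : MemFlow B gIR h)
    (hg : ∀ t, 0 < g t ∧ g t ≤ 1) (hgF : ∀ t, 1 / (1 + ∑ k ∈ range K, L k * h (t + k) ^ 3 / 2) ≤ g t)
    {k₂ k₃ : ℕ} (hk2 : 2 ≤ k₂) (hk23 : k₂ < k₃) (hKk : K = k₃ + 1) (hL3 : ∀ j, j < K → j ≠ 1 → j ≠ k₂ → j ≠ k₃ → L j = 0) {N : ℕ} (hKN : K ≤ N)
    (hKL : ∀ k n l, KL k n l = if 0 < k ∧ k < K ∧ l < k then L k * h (n + k) ^ 3 / 2 * ∏ t ∈ Ico (n + 1 + l) (n + k + 1), g t else 0)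
    {θ : ℕ → ℕ → ℕ → ℝ} (hθ : ∀ k n l, θ k n l = 1 - (h (n + k + l) / h (n + k)) ^ 3 * ∏ t ∈ Ico (n + k + 1) (n + k + l + 1), g t)
    {KA : ℕ → ℕ → ℕ → ℝ} {RL RA SL SA : ℕ → (ℕ → ℝ) → ℕ → ℝ}
    (hRL : ∀ i v m, RL i v m = ∑ l ∈ range K, KL i m l * v (m + 1 + l))
    (hRA : ∀ i v m, RA i v m = ∑ l ∈ range K, KA i m l * v (m + 1 + l))
    (hKA : ∀ i m l, KA i m l = KL i m l + KA (i + 1) m l) (hKAtop : ∀ m l, KA K m l = 0)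
    (hSL : ∀ i (w : ℕ → ℝ), (∀ m, N < m → w m = 0) → (∀ m, N < m → SL i w m = 0) ∧ ∀ m, SL i w m = w m - RL i (SL i w) m)
    (hSA : ∀ i (w : ℕ → ℝ), (∀ m, N < m → w m = 0) → (∀ m, N < m → SA i w m = 0) ∧ ∀ m, SA i w m = w m - RA i (SA i w) m)
    {ρ : ℕ → ℕ → ℝ} {β : ℕ → ℕ → ℕ → ℝ}
    (hρ : ∀ i n, 1 ≤ i → i ≤ K - 1 → ρ i n = (∑ l ∈ range K, KL i n l) * (1 + ∑ k ∈ Ioc i (K - 1), θ k n i * β (i + 1) n k) /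
      (1 - ∑ k ∈ Ioc i (K - 1), ∑ l ∈ range i, KL k n l))
    (hβnew : ∀ i n, 1 ≤ i → i ≤ K - 1 → β i n i = ρ i n / (1 - ρ i n))
    (hβold : ∀ i n k, 1 ≤ i → i < k → k ≤ K - 1 → β i n k = β (i + 1) n k / (1 - ρ i n))
    {Hg : ℕ → ℕ → ℝ} (hH : ∀ i m, Hg i m = (1 + ∑ k ∈ Ioc i (K - 1), θ k m 1 * β (i + 1) m k) / (1 - ∑ k ∈ Ioc i (K - 1), KL k m 0))
    {AL : ℕ → ℕ → ℕ → ℝ} (hAL : ∀ i j p, AL i j p = ∑ l ∈ range i, if p + 1 + l ≤ j then KL i p l * (1 - ρ i (p + 1 + l)) else 0)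
    {Tτ : ℕ → ℕ → ℕ → ℝ} (hTτ : ∀ i m p', Tτ i m p' = max (max (max ((1 - ρ i p') * (1 - ∑ l ∈ range K, KA (i + 1) (m + 2) l))
      ((1 - ρ i p') * (1 - ∑ l ∈ range K, KA (i + 1) p' l))) ((1 - ∑ l ∈ range K, KA (i + 1) p' l) - ∑ l ∈ range K, KL i p' l)) 0)
    {TA : ℕ → ℕ → ℕ → ℕ → ℝ} (hTA : ∀ i j m p, TA i j m p = ∑ l ∈ range i, if p + 1 + l ≤ j then KL i p l * Tτ i m (p + 1 + l) else 0)
    {M : ℕ → ℕ → ℝ} (hM : ∀ i m, M i m = KL i m 0 + ∑ l ∈ range (K - 1), max (KL i m (l + 1) - KL i (m + 1) l) 0)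
    {HgS : ℕ → ℕ → ℕ → ℝ} (hHS : ∀ i j m, HgS i j m = (1 + ∑ k ∈ Ioc i (K - 1), θ k m 1 * β (i + 1) m k) /
      (1 - ∑ k ∈ Ioc i (K - 1), (KL k m 0 - if m + 1 + k ≤ j then KL k (m + 1) (k - 1) else 0)))
    -- THE DISPLAYED FAMILIES
    (hSb1 : ∀ m, (1 + M 1 m) * (Hg 1 (m + 1) * KL 1 (m + 1) 0) ≤ KL 1 m 0)
    (hpair12 : (∀ n, ∑ l ∈ range k₂, KL k₂ (n + 1) l ≤ ∑ l ∈ range k₂, KL k₂ n l) ∨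
      (∀ m, KL k₂ (m + 1) (k₂ - 1) * KL 1 (m + 1 + k₂) 0 * ∏ p ∈ Ico (m + 2) (m + 2 + k₂), Hg 1 p ≤
        KL k₂ m 0 * KL 1 (m + 1) 0 * (1 - KL 1 (m + 2) 0 * Hg 1 (m + 2))))
    (hpair13 : (∀ n, ∑ l ∈ range k₃, KL k₃ (n + 1) l ≤ ∑ l ∈ range k₃, KL k₃ n l) ∨
      (∀ m, KL k₃ (m + 1) (k₃ - 1) * KL 1 (m + 1 + k₃) 0 * ∏ p ∈ Ico (m + 2) (m + 2 + k₃), Hg 1 p ≤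
        KL k₃ m 0 * KL 1 (m + 1) 0 * (1 - KL 1 (m + 2) 0 * Hg 1 (m + 2))))
    (hlev2 : ((∀ m L', L' < k₂ → (1 + M k₂ m) * ∑ l ∈ Ico L' k₂, Hg k₂ (m + 1 + l) * KL k₂ (m + 1) l ≤ ∑ l ∈ Ico L' k₂, KL k₂ m l) ∧
        (∀ m L₀, L₀ < k₂ → ∀ L', L' ≤ L₀ → (1 + M k₂ m) * ∑ l ∈ Ico L' L₀, Hg k₂ (m + 1 + l) * KL k₂ (m + 1) l ≤ ∑ l ∈ Ico L' (L₀ + 1), KL k₂ m l)) ∨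
      (∀ m, KL k₂ (m + 1) (k₂ - 1) ≤ (1 - (1 - θ k₂ m 1)) * ∑ l ∈ range k₂, KL k₂ m l * (1 - ρ k₂ (m + 1 + l)) / ∏ p ∈ Ico (m + 1 + l) (m + 1 + k₂), Hg k₂ p +
        (1 - θ k₂ m 1) * (KL k₂ m 0 * (1 - ρ k₂ (m + 1)) / ∏ p ∈ Ico (m + 1) (m + 1 + k₂), Hg k₂ p)))
    (hpair23 : (∀ n, ∑ l ∈ range k₃, KL k₃ (n + 1) l ≤ ∑ l ∈ range k₃, KL k₃ n l) ∨
      (∀ j m, m + 1 + k₃ ≤ j →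
        KL k₃ (m + 1) (k₃ - 1) * ∑ l ∈ range k₂, (if m + 2 + k₃ + l ≤ j then KL k₂ (m + 1 + k₃) l * ∏ s ∈ Ico (m + 2) (m + 2 + k₃ + l), Hg k₂ s else 0) ≤
          (1 - (1 - θ k₃ m 1)) * ∑ l' ∈ range k₃, KL k₃ m l' * AL k₂ j (m + 1 + l') + (1 - θ k₃ m 1) * (KL k₃ m 0 * AL k₂ j (m + 1))) ∨
      (∀ j m, m + 1 + k₃ ≤ j →
        KL k₃ (m + 1) (k₃ - 1) * ∑ l ∈ range k₂, (if m + 2 + k₃ + l ≤ j then KL k₂ (m + 1 + k₃) l else 0) ≤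
          (1 - (1 - θ k₃ m 1)) * ∑ l' ∈ range k₃, KL k₃ m l' * TA k₂ j m (m + 1 + l') + (1 - θ k₃ m 1) * (KL k₃ m 0 * TA k₂ j m (m + 1))))
    (hM1top : ((∀ m j, m + 1 + N ≤ j → ∀ L', L' < N →
          ∑ l ∈ Ico L' N, HgS k₂ j (m + 1 + l) * KA (k₂ + 1) (m + 1) l ≤ ∑ l ∈ Ico L' N, KA (k₂ + 1) m l) ∧
        (∀ m L₀, L₀ < N → ∀ L', L' ≤ L₀ →
          ∑ l ∈ Ico L' L₀, HgS k₂ (m + 1 + L₀) (m + 1 + l) * KA (k₂ + 1) (m + 1) l ≤ ∑ l ∈ Ico L' (L₀ + 1), KA (k₂ + 1) m l)) ∨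
      (∀ j, j ≤ N → ∀ m, m < j →
        SA (k₂ + 1) (fun m => if m ≤ j then (1:ℝ) else 0) m ≤ SA (k₂ + 1) (fun m => if m ≤ j then (1:ℝ) else 0) (m + 1)))
    {e ε : ℕ → ℝ} (he0 : ∀ m, 0 ≤ e m) (hea : ∀ m, e (m + 1) ≤ e m) (het : ∀ m, N < m → e m = 0)
    (hεt : ∀ m, N < m → ε m = 0) (hεrec : ∀ m, ε m = e m - RA 1 ε m) : ∀ m, 0 ≤ ε m := by
  have hh0 : ∀ n, 0 < h n := fun n => (hh n).1
  have hanti := (strictAnti_of_memFlow hb hlo hh hf).antitone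
  have hKL0 := weight_nonneg hL hh0 hg hKL
  have hsil : ∀ j, j < K → j ≠ 1 → j ≠ k₂ → j ≠ k₃ → ∀ n l, KL j n l = 0 := fun j hj h1 h2 h3 n l => kernel_zero hKL (hL3 j hj h1 h2 h3) n l
  have hcd := fun {k : ℕ} (hrow : ∀ n, ∑ l ∈ range k, KL k (n + 1) l ≤ ∑ l ∈ range k, KL k n l) (m M' : ℕ) =>
    flow_cum_dom_of_rowmass hL hh0 hanti hg hKL hrow m M'
  refine flow_nonneg_of_static_families_entering_abs_horizon hmono hL hb hlo hdom hh hf hg hgF (by omega) hKN hKL hθ hRL hRA hKA hKAtop hSL hSA hρ hβnew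
    hβold hH hAL hTτ hTA (P := fun i => i = k₂ + 1) (fun i k' hi1 hik' hk'K => ?_) hM hHS (fun i hi1 hiK => ?_) (fun i hi1 hiK hP => ?_) he0 hea het hεt hεrec
  · -- the pairs: k' = k₃ (`hpair13` for i = 1, `hpair23` for i = k₂, silent i otherwise); k' = k₂ (`hpair12` or silent i); k' silent
    by_cases hk3 : k' = k₃
    · subst hk3
      rcases Nat.lt_or_ge i 2 with hi | hi
      · rcases hpair13 with hrow | hSd
        · exact Or.inl (hcd hrow)
        · exact Or.inr (Or.inr (Or.inl ⟨by omega, by rw [show i = 1 by omega]; exact hSd⟩))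
      · by_cases hi2 : i = k₂
        · subst hi2
          rcases hpair23 with hrow | hSh | hSh
          · exact Or.inl (hcd hrow)
          · exact Or.inr (Or.inr (Or.inr ⟨rfl, Or.inl hSh⟩))
          · exact Or.inr (Or.inr (Or.inr ⟨rfl, Or.inr hSh⟩))
        · exact Or.inr (Or.inl (hsil i (by omega) (by omega) hi2 (by omega)))
    by_cases hk2' : k' = k₂
    · subst hk2'
      rcases Nat.lt_or_ge i 2 with hi | hi
      · rcases hpair12 with hrow | hSd
        · exact Or.inl (hcd hrow)
        · exact Or.inr (Or.inr (Or.inl ⟨by omega, by rw [show i = 1 by omega]; exact hSd⟩))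
      · exact Or.inr (Or.inl (hsil i (by omega) (by omega) (by omega) (by omega)))
    · refine Or.inl fun m M' => ?_
      have hz := hsil k' (by omega) (by omega) hk2' hk3
      rw [sum_eq_zero fun l _ => hz _ _, sum_eq_zero fun l _ => hz _ _]
  · -- the levels: 1 is one-lag with `hSb1`; k₂ by `hlev2`; the rest are silent
    by_cases hi2 : i = k₂
    · subst hi2
      rcases hlev2 with hTS | hSe
      · exact Or.inr (Or.inr (Or.inl ⟨rfl, hTS⟩))
      · exact Or.inr (Or.inr (Or.inr hSe))
    rcases Nat.lt_or_ge i 2 with hi | hi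
    · obtain rfl : i = 1 := by omega
      exact Or.inl ⟨rfl, hSb1⟩
    · exact Or.inr (Or.inl (hsil i (by omega) (by omega) hi2 (by omega)))
  · -- the top option, only at the `P`-level `i = k₂ + 1`
    subst hP; rw [Nat.add_sub_cancel]; exact hM1top

/-! ## §3 The three-age socket on STATIC families only -/

/-- **THE THREE-AGE SOCKET v3° — STATIC FAMILIES ONLY.**  As §2 `flow_nonneg_three_ages_abs_horizon` with the top option `hM1top` replaced by
`hM1top'` = (S-c♯) above `k₂` ∨ (S-f) for the oldest age ((E86h) `flow_M1_top_of_crit`).  Second members: (S-d), (S-e″), (S-h°), (S-f). [folklore] -/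
theorem flow_nonneg_three_ages_abs_static (hmono : ∀ u v : ℕ → ℝ, SeqBox γ u → SeqBox γ v → (∀ j, u j ≤ v j) → B u ≤ B v)
    (hL : ∀ k, 0 ≤ L k) (hb : 0 < b) (hlo : ∀ u, SeqBox γ u → b ≤ B u) (hdom : ∀ u, SeqBox γ u → ∑ k ∈ range K, L k * u k ≤ B u)
    (hh : SeqBox γ h) (hf : MemFlow B gIR h)
    (hg : ∀ t, 0 < g t ∧ g t ≤ 1) (hgF : ∀ t, 1 / (1 + ∑ k ∈ range K, L k * h (t + k) ^ 3 / 2) ≤ g t)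
    {k₂ k₃ : ℕ} (hk2 : 2 ≤ k₂) (hk23 : k₂ < k₃) (hKk : K = k₃ + 1) (hL3 : ∀ j, j < K → j ≠ 1 → j ≠ k₂ → j ≠ k₃ → L j = 0) {N : ℕ} (hKN : K ≤ N)
    (hKL : ∀ k n l, KL k n l = if 0 < k ∧ k < K ∧ l < k then L k * h (n + k) ^ 3 / 2 * ∏ t ∈ Ico (n + 1 + l) (n + k + 1), g t else 0)
    {θ : ℕ → ℕ → ℕ → ℝ} (hθ : ∀ k n l, θ k n l = 1 - (h (n + k + l) / h (n + k)) ^ 3 * ∏ t ∈ Ico (n + k + 1) (n + k + l + 1), g t)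
    {KA : ℕ → ℕ → ℕ → ℝ} {RL RA SL SA : ℕ → (ℕ → ℝ) → ℕ → ℝ}
    (hRL : ∀ i v m, RL i v m = ∑ l ∈ range K, KL i m l * v (m + 1 + l))
    (hRA : ∀ i v m, RA i v m = ∑ l ∈ range K, KA i m l * v (m + 1 + l))
    (hKA : ∀ i m l, KA i m l = KL i m l + KA (i + 1) m l) (hKAtop : ∀ m l, KA K m l = 0)
    (hSL : ∀ i (w : ℕ → ℝ), (∀ m, N < m → w m = 0) → (∀ m, N < m → SL i w m = 0) ∧ ∀ m, SL i w m = w m - RL i (SL i w) m)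
    (hSA : ∀ i (w : ℕ → ℝ), (∀ m, N < m → w m = 0) → (∀ m, N < m → SA i w m = 0) ∧ ∀ m, SA i w m = w m - RA i (SA i w) m)
    {ρ : ℕ → ℕ → ℝ} {β : ℕ → ℕ → ℕ → ℝ}
    (hρ : ∀ i n, 1 ≤ i → i ≤ K - 1 → ρ i n = (∑ l ∈ range K, KL i n l) * (1 + ∑ k ∈ Ioc i (K - 1), θ k n i * β (i + 1) n k) /
      (1 - ∑ k ∈ Ioc i (K - 1), ∑ l ∈ range i, KL k n l))
    (hβnew : ∀ i n, 1 ≤ i → i ≤ K - 1 → β i n i = ρ i n / (1 - ρ i n))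
    (hβold : ∀ i n k, 1 ≤ i → i < k → k ≤ K - 1 → β i n k = β (i + 1) n k / (1 - ρ i n))
    {Hg : ℕ → ℕ → ℝ} (hH : ∀ i m, Hg i m = (1 + ∑ k ∈ Ioc i (K - 1), θ k m 1 * β (i + 1) m k) / (1 - ∑ k ∈ Ioc i (K - 1), KL k m 0))
    {AL : ℕ → ℕ → ℕ → ℝ} (hAL : ∀ i j p, AL i j p = ∑ l ∈ range i, if p + 1 + l ≤ j then KL i p l * (1 - ρ i (p + 1 + l)) else 0)
    {Tτ : ℕ → ℕ → ℕ → ℝ} (hTτ : ∀ i m p', Tτ i m p' = max (max (max ((1 - ρ i p') * (1 - ∑ l ∈ range K, KA (i + 1) (m + 2) l))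
      ((1 - ρ i p') * (1 - ∑ l ∈ range K, KA (i + 1) p' l))) ((1 - ∑ l ∈ range K, KA (i + 1) p' l) - ∑ l ∈ range K, KL i p' l)) 0)
    {TA : ℕ → ℕ → ℕ → ℕ → ℝ} (hTA : ∀ i j m p, TA i j m p = ∑ l ∈ range i, if p + 1 + l ≤ j then KL i p l * Tτ i m (p + 1 + l) else 0)
    {M : ℕ → ℕ → ℝ} (hM : ∀ i m, M i m = KL i m 0 + ∑ l ∈ range (K - 1), max (KL i m (l + 1) - KL i (m + 1) l) 0)
    {HgS : ℕ → ℕ → ℕ → ℝ} (hHS : ∀ i j m, HgS i j m = (1 + ∑ k ∈ Ioc i (K - 1), θ k m 1 * β (i + 1) m k) /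
      (1 - ∑ k ∈ Ioc i (K - 1), (KL k m 0 - if m + 1 + k ≤ j then KL k (m + 1) (k - 1) else 0)))
    (hSb1 : ∀ m, (1 + M 1 m) * (Hg 1 (m + 1) * KL 1 (m + 1) 0) ≤ KL 1 m 0)
    (hpair12 : (∀ n, ∑ l ∈ range k₂, KL k₂ (n + 1) l ≤ ∑ l ∈ range k₂, KL k₂ n l) ∨
      (∀ m, KL k₂ (m + 1) (k₂ - 1) * KL 1 (m + 1 + k₂) 0 * ∏ p ∈ Ico (m + 2) (m + 2 + k₂), Hg 1 p ≤
        KL k₂ m 0 * KL 1 (m + 1) 0 * (1 - KL 1 (m + 2) 0 * Hg 1 (m + 2))))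
    (hpair13 : (∀ n, ∑ l ∈ range k₃, KL k₃ (n + 1) l ≤ ∑ l ∈ range k₃, KL k₃ n l) ∨
      (∀ m, KL k₃ (m + 1) (k₃ - 1) * KL 1 (m + 1 + k₃) 0 * ∏ p ∈ Ico (m + 2) (m + 2 + k₃), Hg 1 p ≤
        KL k₃ m 0 * KL 1 (m + 1) 0 * (1 - KL 1 (m + 2) 0 * Hg 1 (m + 2))))
    (hlev2 : ((∀ m L', L' < k₂ → (1 + M k₂ m) * ∑ l ∈ Ico L' k₂, Hg k₂ (m + 1 + l) * KL k₂ (m + 1) l ≤ ∑ l ∈ Ico L' k₂, KL k₂ m l) ∧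
        (∀ m L₀, L₀ < k₂ → ∀ L', L' ≤ L₀ → (1 + M k₂ m) * ∑ l ∈ Ico L' L₀, Hg k₂ (m + 1 + l) * KL k₂ (m + 1) l ≤ ∑ l ∈ Ico L' (L₀ + 1), KL k₂ m l)) ∨
      (∀ m, KL k₂ (m + 1) (k₂ - 1) ≤ (1 - (1 - θ k₂ m 1)) * ∑ l ∈ range k₂, KL k₂ m l * (1 - ρ k₂ (m + 1 + l)) / ∏ p ∈ Ico (m + 1 + l) (m + 1 + k₂), Hg k₂ p +
        (1 - θ k₂ m 1) * (KL k₂ m 0 * (1 - ρ k₂ (m + 1)) / ∏ p ∈ Ico (m + 1) (m + 1 + k₂), Hg k₂ p)))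
    (hpair23 : (∀ n, ∑ l ∈ range k₃, KL k₃ (n + 1) l ≤ ∑ l ∈ range k₃, KL k₃ n l) ∨
      (∀ j m, m + 1 + k₃ ≤ j →
        KL k₃ (m + 1) (k₃ - 1) * ∑ l ∈ range k₂, (if m + 2 + k₃ + l ≤ j then KL k₂ (m + 1 + k₃) l * ∏ s ∈ Ico (m + 2) (m + 2 + k₃ + l), Hg k₂ s else 0) ≤
          (1 - (1 - θ k₃ m 1)) * ∑ l' ∈ range k₃, KL k₃ m l' * AL k₂ j (m + 1 + l') + (1 - θ k₃ m 1) * (KL k₃ m 0 * AL k₂ j (m + 1))) ∨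
      (∀ j m, m + 1 + k₃ ≤ j →
        KL k₃ (m + 1) (k₃ - 1) * ∑ l ∈ range k₂, (if m + 2 + k₃ + l ≤ j then KL k₂ (m + 1 + k₃) l else 0) ≤
          (1 - (1 - θ k₃ m 1)) * ∑ l' ∈ range k₃, KL k₃ m l' * TA k₂ j m (m + 1 + l') + (1 - θ k₃ m 1) * (KL k₃ m 0 * TA k₂ j m (m + 1))))
    (hM1top' : ((∀ m j, m + 1 + N ≤ j → ∀ L', L' < N →
          ∑ l ∈ Ico L' N, HgS k₂ j (m + 1 + l) * KA (k₂ + 1) (m + 1) l ≤ ∑ l ∈ Ico L' N, KA (k₂ + 1) m l) ∧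
        (∀ m L₀, L₀ < N → ∀ L', L' ≤ L₀ →
          ∑ l ∈ Ico L' L₀, HgS k₂ (m + 1 + L₀) (m + 1 + l) * KA (k₂ + 1) (m + 1) l ≤ ∑ l ∈ Ico L' (L₀ + 1), KA (k₂ + 1) m l)) ∨
      (∀ m, KL k₃ (m + 1) (k₃ - 1) - (1 - θ k₃ m 1) * KL k₃ m 0 ≤
        (∑ l ∈ range k₃, KL k₃ (m + 1) l * (1 - ∑ l' ∈ range k₃, KL k₃ (m + 2 + l) l')) * (1 - (1 - θ k₃ m 1) - (1 - θ k₃ m 1) * KL k₃ m 0)))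
    {e ε : ℕ → ℝ} (he0 : ∀ m, 0 ≤ e m) (hea : ∀ m, e (m + 1) ≤ e m) (het : ∀ m, N < m → e m = 0)
    (hεt : ∀ m, N < m → ε m = 0) (hεrec : ∀ m, ε m = e m - RA 1 ε m) : ∀ m, 0 ≤ ε m :=
  flow_nonneg_three_ages_abs_horizon hmono hL hb hlo hdom hh hf hg hgF hk2 hk23 hKk hL3 hKN hKL hθ hRL hRA hKA hKAtop hSL hSA hρ hβnew hβold hH hAL hTτ hTA
    hM hHS hSb1 hpair12 hpair13 hlev2 hpair23
    (hM1top'.imp_right fun hSf => flow_M1_top_of_crit hmono hL hb hlo hdom hh hf hg hk2 hk23 hKk hL3 hKN hKL hθ hRL hRA hKA hKAtop hSL hSA hSf)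
    he0 hea het hεt hεrec

end Summit.QuantumFields.BalabanUV.Beta.EriceRemainderEnclosureHistoryAutonomyComparisonAgeCompositionThreeAgesAbs

end
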